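import Mathlib
import Summits.Ventures.PercRepro.TriangleCapFourTable
import Summits.Ventures.PercRepro.TriangleCapNonBipTable
import Summits.Ventures.PercRepro.TriangleCapThreeRowStability
import Summits.Ventures.PercRepro.TriangleCapThreeRowSecondBest
import Summits.Ventures.PercRepro.TriangleCapThreeRowSecondBestCherries
import Summits.Ventures.PercRepro.TriangleCapTFamilyGen

/-!
# PercRepro — THE STABILITY TABLE OF THE ROW `a = 3`, AND OF EVERY ROW `a ≥ 3` (p3, gen 50; part 207)

`stabGapFull k 3 r` IS the row-3 gap: `6 (k − 7)` at `r = 0` (the `B2` family `K_{4,k−4}` minus a `(k − 7)`-star)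
and `2 (k − 7)` at every `r ≥ 1` (the one-triangle family `tFamilyGen (k − 1) 3 (r − 1)`; the `min` of the
`r ≥ a` branch is attained on the one-triangle side since `a − 3 = 0`).  The row `a = 3` was proved in gen 43
(`three_row_second_order_pos`: every non-`3`-bipartite `K₄⁻`-free graph on `(k, 3, r)`, `r ≥ 1`, `r + 7 ≤ k`, is
`≥ 2 (k − 7)` below the closed form) and gen 45 (`nonbip_second_best_table` at `r = 0`); the witnesses are
`tFamilyGen_value` at `a = 3` (gen 45) and the `B2` witness of gen 45.  So the row `a = 3` joins
`stab_table_rows_ge_four`: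

* `stab_table_three` — the row `a = 3` on every cell `r ≥ 0`, `r + 7 ≤ k`, `8 ≤ k`, in `stabGapFull` form;
* `stab_table_rows_ge_three` — **the whole stability table for every row `a ≥ 3`** (`2 a + r ≤ k`, `2 a + 2 ≤ k`,
  and `r + 7 ≤ k` on the row `a = 3`), with no bound on `a`; cherry form `stab_table_rows_ge_three_cherries`;
* `cherry_second_best_three` / `cherry_second_best_ge_three` — the second best among ALL graphs (`≠` the closed
  form) is the broom value `2 (r − 2)` for `r ≥ 3` on every row `a ≥ 3`; cherry form
  `cherry_second_best_ge_three_cherries`.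

Axioms: standard.
-/

namespace PercRepro

namespace TriangleCap

namespace C047

open Finset

/-- `stabGapFull k 3 0 = 2 (k − 7) · 3` (the `B2` regime `r ≤ a − 3` at `r = 0`). -/
theorem stabGapFull_three_zero (k : ℕ) : stabGapFull k 3 0 = 2 * (k - 2 * 3 - 1) * (3 - 0) := by
  unfold stabGapFull
  rw [if_pos (by omega)]

/-- `stabGapFull k 3 r = 2 (k − 7)` for every `r ≥ 1`, `7 ≤ k`: the `T` / `B2` value at `r = 1, 2` and the
one-triangle branch of the `min` at `r ≥ 3` (`2 k − 14 + 2 (r − 3) · 0 ≤ 2 (k − 6) + 2 (r − 3)`). -/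
theorem stabGapFull_three_pos (k r : ℕ) (hr : 1 ≤ r) (hk : 7 ≤ k) : stabGapFull k 3 r = 2 * (k - 7) := by
  unfold stabGapFull
  rw [if_neg (by omega)]
  by_cases h2 : r + 1 ≤ 3
  · rw [if_pos h2]
    omega
  · rw [if_neg h2, min_eq_right]
    · simp only [Nat.sub_self, mul_zero, add_zero]
      omega
    · simp only [Nat.sub_self, mul_zero, add_zero, show (3 : ℕ) - 2 = 1 from rfl, mul_one]
      omega

/-- `nonbipGap k 3 0 = 2 (k − 7) · 3`. -/
theorem nonbipGap_three_zero (k : ℕ) : nonbipGap k 3 0 = 2 * (k - 2 * 3 - 1) * (3 - 0) := by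
  unfold nonbipGap
  rw [if_pos (by omega)]

/-- **THE STABILITY TABLE OF THE ROW `a = 3`** on every cell `(k, 3, r)`, `r + 7 ≤ k`, `8 ≤ k`: every
non-`3`-bipartite `K₄⁻`-free graph with `m + r = 3 (k − 3)` edges satisfies `Σ d² + r (k − 1 − r) + stabGapFull k 3 r
≤ m k`, and some non-`3`-bipartite one attains it (`r = 0`: the `B2` witness of gen 45; `r ≥ 1`: the one-triangle
family `tFamilyGen (k − 1) 3 (r − 1)`). -/
theorem stab_table_three (k r : ℕ) (hk : r + 7 ≤ k) (hk8 : 8 ≤ k) :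
    (∀ (D : SimpleGraph (Fin k)) [DecidableRel D.Adj], K4mFree D → D.edgeFinset.card + r = 3 * (k - 3) →
        (¬ ∃ A : Finset (Fin k), A.card = 3 ∧ BipSub D A) →
        ∑ v, deg D v * deg D v + r * (k - 1 - r) + stabGapFull k 3 r ≤ D.edgeFinset.card * k) ∧
      ∃ (D : SimpleGraph (Fin k)) (_ : DecidableRel D.Adj), K4mFree D ∧ D.edgeFinset.card + r = 3 * (k - 3) ∧
        (¬ ∃ A : Finset (Fin k), A.card = 3 ∧ BipSub D A) ∧
        ∑ v, deg D v * deg D v + r * (k - 1 - r) + stabGapFull k 3 r = D.edgeFinset.card * k := by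
  have hcard : Fintype.card (Fin k) = k := Fintype.card_fin k
  rcases Nat.eq_zero_or_pos r with rfl | hr
  · rw [stabGapFull_three_zero]
    have h := nonbip_second_best_table k 3 0 (le_refl 3) (by omega) hk8 (fun _ => by omega)
    rw [nonbipGap_three_zero] at h
    exact h
  · rw [stabGapFull_three_pos k r hr (by omega)]
    refine ⟨?_, ?_⟩
    · intro D _ hK hm hnb
      have h := three_row_second_order_pos D hK r hr (by rw [hcard]; omega) (by rw [hcard]; omega) hnb
      rw [hcard] at h
      exact h
    · obtain ⟨n, rfl⟩ : ∃ n, k = n + 1 := ⟨k - 1, by omega⟩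
      obtain ⟨r', rfl⟩ : ∃ r', r = r' + 1 := ⟨r - 1, by omega⟩
      obtain ⟨hK, hE, hS, hnb⟩ := tFamilyGen_value n 3 r' (le_refl 3) (by omega) (by omega)
      refine ⟨tFamilyGen n 3 r' (by omega), inferInstance, hK, ?_, fun ⟨A, _, hB⟩ => hnb A hB, ?_⟩
      · have e : r' + 3 - 2 = r' + 1 := by omega
        rw [e] at hE
        exact hE
      · have e : r' + 3 - 2 = r' + 1 := by omega
        rw [e] at hS
        have e2 : 2 * (n - 2 * 3) + 2 * r' * (3 - 3) = 2 * (n + 1 - 7) := by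
          simp only [Nat.sub_self, mul_zero, add_zero]
          omega
        rw [add_assoc, e2] at hS
        exact hS

/-- **THE WHOLE STABILITY TABLE FOR EVERY ROW `a ≥ 3`** (`2 a + r ≤ k`, `2 a + 2 ≤ k`, and `r + 7 ≤ k` on the row
`a = 3`), with no bound on `a`: the non-`a`-bipartite second best of the `K₄⁻`-free cherry table on the cell
`(k, a, r)` is the closed form minus `stabGapFull k a r`, attained. -/
theorem stab_table_rows_ge_three (k a r : ℕ) (ha3 : 3 ≤ a) (hk : 2 * a + r ≤ k) (hk2 : 2 * a + 2 ≤ k)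
    (hk3 : a = 3 → r + 7 ≤ k) :
    (∀ (D : SimpleGraph (Fin k)) [DecidableRel D.Adj], K4mFree D → D.edgeFinset.card + r = a * (k - a) →
        (¬ ∃ A : Finset (Fin k), A.card = a ∧ BipSub D A) →
        ∑ v, deg D v * deg D v + r * (k - 1 - r) + stabGapFull k a r ≤ D.edgeFinset.card * k) ∧
      ∃ (D : SimpleGraph (Fin k)) (_ : DecidableRel D.Adj), K4mFree D ∧ D.edgeFinset.card + r = a * (k - a) ∧
        (¬ ∃ A : Finset (Fin k), A.card = a ∧ BipSub D A) ∧
        ∑ v, deg D v * deg D v + r * (k - 1 - r) + stabGapFull k a r = D.edgeFinset.card * k := by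
  rcases Nat.eq_or_lt_of_le ha3 with rfl | h4
  · exact stab_table_three k r (hk3 rfl) (by omega)
  · exact stab_table_rows_ge_four k a r h4 hk hk2

/-- **THE WHOLE STABILITY TABLE FOR EVERY ROW `a ≥ 3`, CHERRY FORM:** `2 · cherries + r (k − 1 − r) + stabGapFull k a r
≤ m (k − 2)` for every non-`a`-bipartite `K₄⁻`-free graph with `m + r = a (k − a)` edges; attained. -/
theorem stab_table_rows_ge_three_cherries (k a r : ℕ) (ha3 : 3 ≤ a) (hk : 2 * a + r ≤ k) (hk2 : 2 * a + 2 ≤ k)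
    (hk3 : a = 3 → r + 7 ≤ k) :
    (∀ (D : SimpleGraph (Fin k)) [DecidableRel D.Adj], K4mFree D → D.edgeFinset.card + r = a * (k - a) →
        (¬ ∃ A : Finset (Fin k), A.card = a ∧ BipSub D A) →
        2 * cherries D + r * (k - 1 - r) + stabGapFull k a r ≤ D.edgeFinset.card * (k - 2)) ∧
      ∃ (D : SimpleGraph (Fin k)) (_ : DecidableRel D.Adj), K4mFree D ∧ D.edgeFinset.card + r = a * (k - a) ∧
        (¬ ∃ A : Finset (Fin k), A.card = a ∧ BipSub D A) ∧
        2 * cherries D + r * (k - 1 - r) + stabGapFull k a r = D.edgeFinset.card * (k - 2) := by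
  have hcard : Fintype.card (Fin k) = k := Fintype.card_fin k
  obtain ⟨h1, D, inst, hK, hE, hnb, hS⟩ := stab_table_rows_ge_three k a r ha3 hk hk2 hk3
  refine ⟨?_, D, inst, hK, hE, hnb, ?_⟩
  · intro D _ hK hm hnb
    have h := h1 D hK hm hnb
    have := (sum_deg_sq_le_iff_cherries D (r * (k - 1 - r) + stabGapFull k a r) (by rw [hcard]; omega)).mp
      (by rw [hcard]; rw [← add_assoc]; exact h)
    rw [hcard] at this
    rw [add_assoc]
    exact this
  · have := (sum_deg_sq_eq_iff_cherries D (r * (k - 1 - r) + stabGapFull k a r) (by rw [hcard]; omega)).mp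
      (by rw [hcard]; rw [← add_assoc]; exact hS)
    rw [hcard] at this
    rw [add_assoc]
    exact this

/-- `secondGapThree k r = 2 (r − 2)` for `r ≥ 3`. -/
theorem secondGapThree_of_three_le (k r : ℕ) (hr : 3 ≤ r) : secondGapThree k r = 2 * (r - 2) := by
  unfold secondGapThree
  rw [if_neg (by omega)]
  congr 1
  omega

/-- **THE SECOND BEST AMONG ALL GRAPHS ON THE ROW `a = 3`, `r ≥ 3`, `r + 7 ≤ k`:** the broom value `2 (r − 2)` below
the closed form, attained (gen 43's `three_row_second_best` in the cell coordinates of the table). -/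
theorem cherry_second_best_three (k r : ℕ) (hr3 : 3 ≤ r) (hk : r + 7 ≤ k) :
    (∀ (D : SimpleGraph (Fin k)) [DecidableRel D.Adj], K4mFree D → D.edgeFinset.card + r = 3 * (k - 3) →
        ∑ v, deg D v * deg D v + r * (k - 1 - r) ≠ D.edgeFinset.card * k →
        ∑ v, deg D v * deg D v + r * (k - 1 - r) + 2 * (r - 2) ≤ D.edgeFinset.card * k) ∧
      ∃ (D : SimpleGraph (Fin k)) (_ : DecidableRel D.Adj), K4mFree D ∧ D.edgeFinset.card + r = 3 * (k - 3) ∧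
        ∑ v, deg D v * deg D v + r * (k - 1 - r) + 2 * (r - 2) = D.edgeFinset.card * k := by
  obtain ⟨hbound, D, inst, hK, hm, hS⟩ := three_row_second_best k r (by omega) hk
  rw [secondGapThree_of_three_le k r hr3] at hbound hS
  refine ⟨?_, D, inst, hK, by omega, hS⟩
  intro D' _ hK' hm' hne
  exact hbound D' hK' (by omega) hne

/-- **THE SECOND BEST AMONG ALL GRAPHS FOR EVERY ROW `a ≥ 3`, `r ≥ 3`, `2 a + r ≤ k` (`r + 7 ≤ k` on the row
`a = 3`):** the broom value `2 (r − 2)` below the closed form, attained. -/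
theorem cherry_second_best_ge_three (k a r : ℕ) (ha3 : 3 ≤ a) (hr3 : 3 ≤ r) (hk : 2 * a + r ≤ k)
    (hk3 : a = 3 → r + 7 ≤ k) :
    (∀ (D : SimpleGraph (Fin k)) [DecidableRel D.Adj], K4mFree D → D.edgeFinset.card + r = a * (k - a) →
        ∑ v, deg D v * deg D v + r * (k - 1 - r) ≠ D.edgeFinset.card * k →
        ∑ v, deg D v * deg D v + r * (k - 1 - r) + 2 * (r - 2) ≤ D.edgeFinset.card * k) ∧
      ∃ (D : SimpleGraph (Fin k)) (_ : DecidableRel D.Adj), K4mFree D ∧ D.edgeFinset.card + r = a * (k - a) ∧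
        ∑ v, deg D v * deg D v + r * (k - 1 - r) + 2 * (r - 2) = D.edgeFinset.card * k := by
  rcases Nat.eq_or_lt_of_le ha3 with rfl | h4
  · exact cherry_second_best_three k r hr3 (hk3 rfl)
  · exact cherry_second_best_all k a r h4 hr3 hk

/-- **THE SECOND BEST AMONG ALL GRAPHS FOR EVERY ROW `a ≥ 3`, `r ≥ 3`, CHERRY FORM:** `2 · cherries + r (k − 1 − r)
≠ m (k − 2)` forces `2 · cherries + r (k − 1 − r) + 2 (r − 2) ≤ m (k − 2)`; attained. -/
theorem cherry_second_best_ge_three_cherries (k a r : ℕ) (ha3 : 3 ≤ a) (hr3 : 3 ≤ r) (hk : 2 * a + r ≤ k)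
    (hk3 : a = 3 → r + 7 ≤ k) :
    (∀ (D : SimpleGraph (Fin k)) [DecidableRel D.Adj], K4mFree D → D.edgeFinset.card + r = a * (k - a) →
        2 * cherries D + r * (k - 1 - r) ≠ D.edgeFinset.card * (k - 2) →
        2 * cherries D + r * (k - 1 - r) + 2 * (r - 2) ≤ D.edgeFinset.card * (k - 2)) ∧
      ∃ (D : SimpleGraph (Fin k)) (_ : DecidableRel D.Adj), K4mFree D ∧ D.edgeFinset.card + r = a * (k - a) ∧
        2 * cherries D + r * (k - 1 - r) + 2 * (r - 2) = D.edgeFinset.card * (k - 2) := by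
  have hcard : Fintype.card (Fin k) = k := Fintype.card_fin k
  obtain ⟨h1, D, inst, hK, hE, hS⟩ := cherry_second_best_ge_three k a r ha3 hr3 hk hk3
  refine ⟨?_, D, inst, hK, hE, ?_⟩
  · intro D _ hK hm hne
    have hne' : ∑ v, deg D v * deg D v + r * (k - 1 - r) ≠ D.edgeFinset.card * k := by
      intro heq
      apply hne
      have := (sum_deg_sq_eq_iff_cherries D (r * (k - 1 - r)) (by rw [hcard]; omega)).mp (by rw [hcard]; exact heq)
      rw [hcard] at this
      exact this
    have h := h1 D hK hm hne'
    have := (sum_deg_sq_le_iff_cherries D (r * (k - 1 - r) + 2 * (r - 2)) (by rw [hcard]; omega)).mp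
      (by rw [hcard]; rw [← add_assoc]; exact h)
    rw [hcard] at this
    rw [add_assoc]
    exact this
  · have := (sum_deg_sq_eq_iff_cherries D (r * (k - 1 - r) + 2 * (r - 2)) (by rw [hcard]; omega)).mp
      (by rw [hcard]; rw [← add_assoc]; exact hS)
    rw [hcard] at this
    rw [add_assoc]
    exact this

end C047

end TriangleCap

end PercRepro
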